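import Summits.BirchSwinnertonDyer.BirchSwinnertonDyer.Theses.PrintCf2
import Literature.NumberTheory.EllipticCurves.CanonicalPAdicHeightCycExistenceHolds
import HarnessLib

/-!
# Route A `PrintCf2`, aside item stmt-BirchSwinnertonDyer-27315 `ExistsIsCanonicalCyc` — CLOSED BY A THEOREM

Cell `bsd-print-cf2`, width seat `bsd-line-cf2-p1-w8` (g29). The route-A aside `PrintCf2.ExistsIsCanonicalCyc`
(`Theses/PrintCf2.lean`; `:= WeierstrassCurve.exists_isCanonicalCyc`, the named fact of
`Literature/NumberTheory/EllipticCurves/CanonicalPAdicHeightCyc.lean` §3: existence and `Aut(H/ℚ)`-invariance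
of THE canonical cyclotomic `p`-adic height datum on `E(H)` for every number field `H` and every good
ordinary prime `p`, sigma-squared form, absolute normalisation) was filed (planner g25, rev 62) as a
CITE-ONLY fact-aside of the line `disegni_pair_two` on crux stmt-BirchSwinnertonDyer-20368. It is now a
THEOREM of the tree: `WeierstrassCurve.exists_isCanonicalCyc_holds`
(`CanonicalPAdicHeightCycExistenceHolds.lean`; programme of -w8 g28 at `p = 2` — Mazur–Stein–Tate 2006
§2.6–2.8 on `Σ = σ²` read at the embeddings `H → ℂ_p` — made `p`-generic by -w8 g29: embedding-wise locus
subgroups, Jordan–von Neumann on a torsion-free core, the cyclic-group trick, and the Mazur–Tate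
sigma(-squared) pair at every good ordinary prime from `mazurTate_sigmaSq_existsUnique_two_holds` /
`mazur_tate_sigma_exists_odd_holds`). This file closes the item BY NAME. THEOREMS ONLY; no `sorry`; no
new definitions. BSD is not proved by any of this; 20368 is not closed here.
-/

-- D-0017 layout: summit = sub-problem, so `Summit.BirchSwinnertonDyer.BirchSwinnertonDyer.…` repeats a path component.
set_option linter.dupNamespace false

namespace Summit.BirchSwinnertonDyer.BirchSwinnertonDyer.Theorems

/-- **Item stmt-BirchSwinnertonDyer-27315 `PrintCf2.ExistsIsCanonicalCyc`, proved**: THE canonical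
cyclotomic `p`-adic height datum over every number field `H` exists at every good ordinary prime `p` of
every elliptic curve over `ℚ` (globally minimal model), and is `Aut(H/ℚ)`-invariant — the tree theorem
`WeierstrassCurve.exists_isCanonicalCyc_holds`. [cite: MazurSteinTate2006, §2.7–2.8 (PDF p. 11 L7–58)]
[cite: MazurTate1991, Thm. 3.1] [cite: Schneider1982, §1] [cite: Disegni2017, §1.3.1 (arXiv v3 PDF p. 7 L30–38)] -/
theorem existsIsCanonicalCyc_proof :
    Summit.BirchSwinnertonDyer.BirchSwinnertonDyer.Theses.PrintCf2.ExistsIsCanonicalCyc :=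
  WeierstrassCurve.exists_isCanonicalCyc_holds

end Summit.BirchSwinnertonDyer.BirchSwinnertonDyer.Theorems
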